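import Literature.IUT.HodgeTheaters.PMBaseProcessionsProofs

/-!
# Proofs for [IUTchI] Proposition 6.7: the `𝒟-Θ`-bridge produced from a `𝒟-Θ^±`-bridge IS a `𝒟-Θ`-bridge

Mochizuki, *Inter-universal Teichmüller theory I*, §6, Proposition 6.7 p. 167, with Definition 4.6 (ii)
p. 111 and Example 4.4 (i)–(iv) pp. 105–107 (kurims manuscript, May 2020). PROOF-ONLY companion
(theorems, no definitions) to abc-iut-L5-t4's `PMBaseProcessions.lean` (the construction
`DThetaPMBridge.thetaBridgeData` and the named statement `DThetaPMBridge.ThetaBridgeAlgorithm`), by the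
wave-4 discharge seat abc-iut-w4-d054 (DAG node IUTchI:Prop6.7; FACT-LIST row F-2035).

The typed statement `ThetaBridgeAlgorithm M IsDThetaBridge hl := ∀ B, IsDThetaBridge (B.thetaBridgeData M hl)`
takes abc-iut-L5-t3's `𝒟-Θ`-bridge predicate of Def 4.6 (ii) as a PARAMETER.  Def 4.6 (ii) p. 111 reads:
a `𝒟-Θ`-bridge is a poly-morphism `†𝔇_J → †𝔇_>` "such that there exist isomorphisms `𝔇_> ⥲ †𝔇_>`,
`𝔇_⋇ ⥲ †𝔇_J`, conjugation by which maps `φ^Θ_⋇ ↦ †φ^Θ_⋇`", where `φ^Θ_⋇ : 𝔇_⋇ → 𝔇_>` is the MODEL of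
Example 4.4 (iv): the capsule `𝔇_⋇ = {𝔇_j}_{j ∈ 𝔽_l^⋇}` of copies of the tautological `𝒟`-prime-strip,
`𝔇_>` a further copy, `φ^Θ_{v_j}` "the full poly-isomorphism" at `v ∈ 𝕍^good` (Ex 4.4 (iii)) and, at
`v ∈ 𝕍^bad`, "the poly-morphism given by the collection of morphisms obtained by composing with
arbitrary isomorphisms `𝒟_{v_j} ⥲ ℬ^temp(Π_v)⁰`, `ℬ^temp(Π_v)⁰ ⥲ 𝒟_{>,v}` the various morphisms … that
arise … from the evaluation sections labeled `j`" (Ex 4.4 (ii) p. 107) — over t4's §4-input kit these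
are the sets `MultKit.thetaPolyBad j v`.

What is PROVED here, for every base kit `K` with `l` odd, every `M : K.MultKit` and every
`𝒟-Θ^±`-bridge `B`:

* `starLabel_bijective`: the labelling `T^⋇ ⥲ 𝔽_l^⋇ = {1, …, l^⋇}` of Def 6.4 (i) used by the
  algorithm is a BIJECTION (index-set half of "`𝔇_⋇ ⥲ †𝔇_{T^⋇}`");
* `exists_labelCompatible`: the identifications of the constituents of `B` with the models coming
  from Def 6.4 (i) ("there exist isomorphisms `𝔇_≻ ⥲ †𝔇_≻`, `𝔇_± ⥲ †𝔇_T` conjugation by which maps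
  `φ^{Θ±}_± ↦ †φ^{Θ±}_±`") satisfy the label-compatibility condition under which `thetaBridgeData`
  transports the model poly-morphisms at `v ∈ 𝕍^bad`;
* `thetaBridgeAlgorithm_of_modelConjugate` (**Prop 6.7, inhabitant form**): for EVERY predicate
  `P` on `𝒟-Θ`-bridge data that holds on all conjugates of the Example-4.4 model bridge — i.e. every
  `P` satisfying Def 4.6 (ii)'s defining closure condition — `ThetaBridgeAlgorithm M P hl` holds;
  equivalently (`thetaBridgeAlgorithm_isModelConjugate`) the output `B.thetaBridgeData M hl` of the
  functorial algorithm admits isomorphisms `𝔇_> ⥲ †𝔇_>`, `𝔇_⋇ ⥲ †𝔇_{T^⋇}` (a bijection of index sets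
  `T^⋇ ⥲ 𝔽_l^⋇` and isomorphisms of the constituent `𝒟`-prime-strips with the models) conjugation by
  which carries the model poly-morphisms (`thetaPolyBad` at bad `v`, the full poly-isomorphism at good
  `v`) EXACTLY onto its constituent poly-morphisms.

The one input beyond the frozen signatures is the PRINTED shape of the Example-4.4 poly-morphism at
`v ∈ 𝕍^bad` quoted above — "composing with ARBITRARY isomorphisms" on both sides, so that
`φ^Θ_{v_j}` is stable under pre- and post-composition with automorphisms of the model — which the bare
field `MultKit.thetaPolyBad` (a `Set` with no law) does not record; it enters as the explicit
hypothesis `hbad` (no new `Prop` fact is declared).  Record only; [claim: Mochizuki2012, status: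
disputed]; nothing here takes a side on any disputed step of inter-universal Teichmüller theory.
-/

namespace Literature.IUT.HodgeTheaters

open CategoryTheory

universe u

namespace PMBaseKit

variable {l : ℕ} {K : PMBaseKit.{u} l}

namespace DThetaPMBridge

variable (B : K.DThetaPMBridge)

/-! ### The index-set half: `T^⋇ ⥲ 𝔽_l^⋇` -/

/-- **Def 6.4 (i) / Prop 6.7, index sets**: the canonical labelling `starLabel : T^⋇ → 𝔽_l^⋇ = {1, …, l^⋇}`
(shifted to `Fin l^⋇`) "determined by the `𝔽_l^±`-group structure of `T`" is a BIJECTION, for `l` odd —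
the bijection of index sets underlying the capsule isomorphism `𝔇_⋇ ⥲ †𝔇_{T^⋆}` required by
[IUTchI] Def 4.6 (ii) p. 111 for the output of Prop 6.7 p. 167. [claim: Mochizuki2012, status: disputed] -/
theorem starLabel_bijective (hl : Odd l) : Function.Bijective (B.starLabel hl) := by
  constructor
  · intro q₁ q₂ h
    have h₁ := B.absLabel_pos_le hl q₁
    have h₂ := B.absLabel_pos_le hl q₂
    have hv : (B.starLabel hl q₁).val = (B.starLabel hl q₂).val := congrArg Fin.val h
    have hv' : B.absLabel q₁.1 - 1 = B.absLabel q₂.1 - 1 := hv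
    have heq : B.absLabel q₁.1 = B.absLabel q₂.1 := by omega
    exact Subtype.ext (B.absLabel_injective hl heq)
  · intro n
    obtain ⟨q, hq⟩ := B.exists_absLabel_eq hl (n := n.val + 1) (by have := n.isLt; omega)
    have hq0 : q ≠ B.grpT.toAbs B.grpT.zero := by
      intro h
      rw [h, absLabel_toAbs_zero] at hq
      omega
    refine ⟨⟨q, hq0⟩, Fin.ext ?_⟩
    show B.absLabel q - 1 = n.val
    omega

/-! ### The label-compatibility of the Def 6.4 (i) identifications -/

/-- For every `𝒟-Θ^±`-bridge `†φ^{Θ±}_± : †𝔇_T → †𝔇_≻` there are identifications `β : 𝔇_≻ ⥲ †𝔇_≻` and, for each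
`t ∈ T`, `κ_t : 𝔇_t ⥲ †𝔇_t` of the constituents with the tautological `𝒟`-prime-strip — namely the
isomorphisms "`𝔇_≻ ⥲ †𝔇_≻`, `𝔇_± ⥲ †𝔇_T` … conjugation by which maps `φ^{Θ±}_± ↦ †φ^{Θ±}_±`" of [IUTchI]
Def 6.4 (i) p. 162 — along which EVERY constituent `f ∈ †φ^{Θ±}_t` induces the identity on
`LabCusp^±(𝒟_v)` at every `v` (because the model `φ^{Θ±}_t` is the positive `+`-full poly-isomorphism,
Example 6.2 (i) p. 160): the compatibility condition under which the algorithm of Prop 6.7 p. 167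
transports the Example-4.4 poly-morphisms. [claim: Mochizuki2012, status: disputed] -/
theorem exists_labelCompatible :
    ∃ β : (DStrip.model K).Iso B.codomain, ∀ t : B.T, ∃ κ : (DStrip.model K).Iso (B.capsule t),
      ∀ f ∈ B.poly t, ∀ v, K.labMap v (κ v ≪≫ f v ≪≫ (β v).symm) = Equiv.refl _ := by
  obtain ⟨ι, -, α, β, hpoly⟩ := B.exists_model
  refine ⟨β, fun t => ?_⟩
  obtain ⟨z, rfl⟩ := ι.surjective t
  refine ⟨α z, fun f hf v => ?_⟩
  rw [hpoly z] at hf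
  obtain ⟨g, hg, rfl⟩ := hf
  have hgv : K.labMap v (g v) = Equiv.refl _ := (K.mem_autPlus_iff _).mp ((hg v).1 rfl)
  have hcomp : α z v ≪≫ (((α z).symm.trans g).trans β) v ≪≫ (β v).symm = g v := by
    ext
    simp [DStrip.Iso.trans, DStrip.Iso.symm]
  rw [hcomp, hgv]

/-! ### Proposition 6.7: the output of the functorial algorithm is a `𝒟-Θ`-bridge -/

/-- **Prop 6.7 (inhabitant form)** ([IUTchI] Prop 6.7 p. 167: the functorial algorithm
`†φ^{Θ±}_± ↦ (†φ^Θ_⋇ : †𝔇_{T^⋇} → †𝔇_>)` outputs "a `𝒟-Θ`-bridge … as in Definition 4.6, (ii)").  Def 4.6 (ii)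
p. 111 DEFINES a `𝒟-Θ`-bridge by the closure condition "there exist isomorphisms `𝔇_> ⥲ †𝔇_>`,
`𝔇_⋇ ⥲ †𝔇_J`, conjugation by which maps `φ^Θ_⋇ ↦ †φ^Θ_⋇`" relative to the model `φ^Θ_⋇` of Example 4.4 (iv)
(poly-morphisms `φ^Θ_{v_j}` = the sets `M.thetaPolyBad j v` at `v ∈ 𝕍^bad`, the full poly-isomorphism at
`v ∈ 𝕍^good`, between copies of the tautological strip).  PROVED: for EVERY predicate `P` on `𝒟-Θ`-bridge
data satisfying that closure condition — `P D` whenever `D` carries a bijection of index sets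
`J ⥲ 𝔽_l^⋇`, isomorphisms `κ_j : 𝔇_j ⥲ †𝔇_j`, `δ : 𝔇_> ⥲ †𝔇_>` and has as constituent poly-morphisms EXACTLY
the conjugates `κ_j⁻¹ ∘ φ^Θ_{v_j} ∘ δ` — the named statement `ThetaBridgeAlgorithm M P hl` holds, i.e.
`P (B.thetaBridgeData M hl)` for every `𝒟-Θ^±`-bridge `B`.  Hypothesis `hbad` = the printed shape of
`φ^Θ_{v_j}` at `v ∈ 𝕍^bad`, "the collection of morphisms obtained by composing with ARBITRARY isomorphisms
`𝒟_{v_j} ⥲ ℬ^temp(Π_v)⁰`, `ℬ^temp(Π_v)⁰ ⥲ 𝒟_{>,v}` the various morphisms … that arise … from the evaluation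
sections labeled `j`" (Ex 4.4 (ii) p. 107), hence stable under automorphisms of the model on both
sides — a law of the printed object not carried by the bare field `MultKit.thetaPolyBad`.
[claim: Mochizuki2012, status: disputed] -/
theorem thetaBridgeAlgorithm_of_modelConjugate (M : K.MultKit) (hl : Odd l)
    (hbad : ∀ (j : Fin ((l - 1) / 2)) (v : K.V) (hv : v ∈ K.bad) (a b : K.model v ≅ K.model v)
      (g : K.model v ⟶ K.model v), g ∈ M.thetaPolyBad j v hv → a.hom ≫ g ≫ b.hom ∈ M.thetaPolyBad j v hv)
    (P : K.DThetaBridgeData → Prop)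
    (hP : ∀ (D : K.DThetaBridgeData) (e : D.J ≃ Fin ((l - 1) / 2))
        (κ : ∀ j, (DStrip.model K).Iso (D.capsule j)) (δ : (DStrip.model K).Iso D.codomain),
        (∀ (j : D.J) (v : K.V) (hv : v ∈ K.bad), D.poly j v =
            {h | ∃ g ∈ M.thetaPolyBad (e j) v hv, h = (κ j v).inv ≫ g ≫ (δ v).hom}) →
        (∀ (j : D.J) (v : K.V), v ∉ K.bad → D.poly j v =
            {h | ∃ g : K.model v ≅ K.model v, h = (κ j v).inv ≫ g.hom ≫ (δ v).hom}) →
        P D) :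
    DThetaPMBridge.ThetaBridgeAlgorithm M P hl := by
  intro B
  obtain ⟨β, hβ⟩ := B.exists_labelCompatible
  choose κ hκ using hβ
  refine hP (B.thetaBridgeData M hl)
    (Equiv.ofBijective (fun q : ULift.{u, 0} B.grpT.AbsStar => B.starLabel hl q.down)
      ((B.starLabel_bijective hl).comp Equiv.ulift.bijective))
    (fun q => κ (Quotient.out q.down.1)) β ?_ ?_
  · -- bad places: the transported Example-4.4 poly-morphism is ONE conjugate of `thetaPolyBad`
    intro q v hv
    ext h
    dsimp only [thetaBridgeData, DThetaPMBridge.starCapsule, DThetaPMBridge.absCapsule]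
    rw [dif_pos hv]
    constructor
    · rintro ⟨α', β', -, g, hg, rfl⟩
      refine ⟨(α' ≪≫ (κ (Quotient.out q.down.1) v).symm).inv ≫ g ≫ (β' ≪≫ (β v).symm).hom,
        hbad _ v hv (α' ≪≫ (κ (Quotient.out q.down.1) v).symm).symm (β' ≪≫ (β v).symm) g hg, ?_⟩
      simp
    · rintro ⟨g, hg, rfl⟩
      exact ⟨κ (Quotient.out q.down.1) v, β v, fun f hf => hκ (Quotient.out q.down.1) f hf v,
        g, hg, rfl⟩
  · -- good places: the transported full poly-isomorphism is the full poly-isomorphism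
    intro q v hv
    ext h
    dsimp only [thetaBridgeData, DThetaPMBridge.starCapsule, DThetaPMBridge.absCapsule]
    rw [dif_neg hv]
    constructor
    · rintro ⟨f, rfl⟩
      exact ⟨κ (Quotient.out q.down.1) v ≪≫ f ≪≫ (β v).symm, by simp⟩
    · rintro ⟨g, rfl⟩
      exact ⟨(κ (Quotient.out q.down.1) v).symm ≪≫ g ≪≫ β v, by simp⟩

/-- **Prop 6.7, as printed** ([IUTchI] Prop 6.7 p. 167 with Def 4.6 (ii) p. 111): the output
`†φ^Θ_⋇ : †𝔇_{T^⋇} → †𝔇_>` of the functorial algorithm applied to ANY `𝒟-Θ^±`-bridge `B` IS a `𝒟-Θ`-bridge in the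
sense of Def 4.6 (ii) relative to the Example-4.4 model over the §4-input kit `M`: "there exist
isomorphisms `𝔇_> ⥲ †𝔇_>`, `𝔇_⋇ ⥲ †𝔇_J`" — a bijection of index sets `T^⋇ ⥲ 𝔽_l^⋇` together with isomorphisms
of the constituent `𝒟`-prime-strips with the tautological one — "conjugation by which maps
`φ^Θ_⋇ ↦ †φ^Θ_⋇`": at `v ∈ 𝕍^bad` the constituent poly-morphism is exactly the conjugate of `φ^Θ_{v_j}`
(`M.thetaPolyBad j v`, Ex 4.4 (ii)), at `v ∈ 𝕍^good` exactly the (conjugate of the) full poly-isomorphism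
(Ex 4.4 (iii)).  This is `ThetaBridgeAlgorithm M P hl` for `P` = the literal Def 4.6 (ii) condition;
hypothesis `hbad` as in `thetaBridgeAlgorithm_of_modelConjugate` (the printed bi-invariance of
`φ^Θ_{v_j}`, Ex 4.4 (ii) p. 107). [claim: Mochizuki2012, status: disputed] -/
theorem thetaBridgeAlgorithm_isModelConjugate (M : K.MultKit) (hl : Odd l)
    (hbad : ∀ (j : Fin ((l - 1) / 2)) (v : K.V) (hv : v ∈ K.bad) (a b : K.model v ≅ K.model v)
      (g : K.model v ⟶ K.model v), g ∈ M.thetaPolyBad j v hv → a.hom ≫ g ≫ b.hom ∈ M.thetaPolyBad j v hv) :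
    DThetaPMBridge.ThetaBridgeAlgorithm M
      (fun D => ∃ (e : D.J ≃ Fin ((l - 1) / 2)) (κ : ∀ j, (DStrip.model K).Iso (D.capsule j))
          (δ : (DStrip.model K).Iso D.codomain),
        (∀ (j : D.J) (v : K.V) (hv : v ∈ K.bad), D.poly j v =
            {h | ∃ g ∈ M.thetaPolyBad (e j) v hv, h = (κ j v).inv ≫ g ≫ (δ v).hom}) ∧
        (∀ (j : D.J) (v : K.V), v ∉ K.bad → D.poly j v =
            {h | ∃ g : K.model v ≅ K.model v, h = (κ j v).inv ≫ g.hom ≫ (δ v).hom}))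
      hl :=
  thetaBridgeAlgorithm_of_modelConjugate M hl hbad _ fun _ e κ δ h₁ h₂ => ⟨e, κ, δ, h₁, h₂⟩

end DThetaPMBridge

end PMBaseKit

end Literature.IUT.HodgeTheaters
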